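import Summits.QuantumFields.YangMills.Theorems.BalabanUVNodesN12AtRecord13Prop1KnitThm1WindowDirectDatumScaleLettersDischargedAtLengthOfThm1NamedFactsGOfRecord
import HarnessLib

/-!
# BalabanUVNodes ∕ N12 — THE JUNCTION OF RECORD's HEIGHT CEILING: its εreg-blind numerics `ν₀` and the cube-divisibility row serve EXACTLY the heights `k ≤ m + K − 4`
# (kernel certificate, typing-range ∕ A2 species; [Balaban1988Convergent] (2.13) pp.256–257 (`LᵏξM₁`-cubes), p.245 (`M₁ < M₂ < M`); [Balaban1987RG1] (0.1) p.251 (`T_ε`, `L_μ = L^m`,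
# «m a positive integer»), p.257 (`M = L^m` ≫ `M₀, M₁`), Thm 3 p.264 (`M ≥ M(κ)`); [Balaban1985Variational] (1) p.277, Thm 1 (8) p.279 (M-cubes); [Balaban1989LargeFieldI] Prop. 1 p.194)

Cell `pub-ymgap` (HUMAN RULINGS D-0062 ∕ D-0149), seat `pub-ymgap-dag-n12-d` g29 (R134 N12 [B15] s2 = by-name knit at the record; count-neutral helper of K1⁹
`stmt-QuantumFields-27364`, `--kind proof --supports … --as helper`).  THEOREMS ONLY (0 `def`, 0 `instance`, 0 `sorry`); elementary ℕ-arithmetic over two DISPLAYED rows of the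
junction of record.  Companion of `BalabanUVNodesN12DirectWindowDatumScaleInhabited` (the numeric window is inhabited); this file reads the `M₁`-rows against the torus.

WHY.  The junction of record v14ᴸ ✓p753865 `…WindowDirectDatumScaleLettersDischargedAtLengthOfThm1NamedFactsGOfRecord` (plan g94 WORD (D1), chair #10983; rows token-identical in
v14 ✓p751583 ∕ L7 ✓p753864) instantiates the (J0′) head at εreg-blind numerics `ν₀ : Stage7Numerics` and displays, before `Θ`, the head's four `M₁`-rows — `hfloor₀ : (d+14)·L ≤ ν₀.M₁`,
`hMrad₀ : (4d+m′)·L² + 2dL + 12 ≤ ν₀.M₁`, `hM₁₀ : ((d+4)L+6)·L² ≤ ν₀.M₁` and, per instance, the CUBE ROW `hdiv₀ : side L ν₀.M₁ (k P i) ∣ sitesPerDir 0` (the `LᵏM₁`-cubes of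
[III] (2.13) tile the torus `T^{(0)}`: `B14.Eq213MaximalDomains.side L M₁ k = Lᵏ·M₁`, `Params.sitesPerDir 0 = 2·L^{m+K}`) — together with `hk1 : k P i + 1 ≤ m + K` and
`hkc ∕ hc : k P i + c ≤ m + K, 4d + m′ + 3 < 2Lᶜ` (so `c ≥ 2`).  Read against each other, `hM₁₀` and `hdiv₀` say MORE than the displayed height rows: `M₁ > 2L³` and
`Lᵏ·M₁ ≤ 2·L^{m+K}` force `k + 4 ≤ m + K`.

WHAT THIS FILE CERTIFIES (kernel).  §1 `height_add_four_le_of_cubeRows`: at one instance, `hM₁₀ ∧ hdiv₀ ⊢ k + 4 ≤ F.m + P.K` (any family: only `1 < L` is used).  §2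
`cubeRows_of_height_add_four_le`: conversely, for a `T4Family` (`d = 4`, `L` odd `> 11`), at every height with `k + 4 ≤ F.m + P.K` the choice `M₁ := L⁴` meets ALL six displayed
`M₁`-rows `hfloor₀ hMrad₀ hM₁₀ hdiv₀ hM4 hM2` verbatim — so the ceiling is SHARP: the junction of record serves EXACTLY the heights `k ≤ m + K − 4`.  §3 `not_cubeRows_of_lt`: the
contrapositive as the quotable sentence — at a family with `F.m ≤ 3`, for the top `4 − m` RG heights `k ∈ {m+K−3, …, K}` NO `ν₀` meets `hM₁₀ ∧ hdiv₀`.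

LOCATED (typing-range, A2-species, count-neutral; NOT a flag, NOT a gap in print; lit-balaban ME #50, cell bus 2026-08-30T01:46:52Z, AS PRINTED).  The only explicit printed
range for `m` is [I] p.251 «We take L_μ = L^m, where L is an odd, positive integer > 11, and m is a positive integer»; but print COUPLES the torus to the localisation cubes with the
same letter: [I] p.257 «We decompose the space T into the lattice of closed cubes of a size M, where M = L^m … we choose the size M much bigger than the previously fixed scales»
(`M₀`, `M₁`), [I] Thm 3 p.264 «M ≥ M(κ)», [III] p.245 «M₁ < M₂ < M … e.g. M₂ = L²M₁, and M will be chosen much larger than M₂», [15] p.277 ∕ p.279 (M-cubes, `M` a multiple of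
`R₁M₁`).  So in print the step-`j` unit torus is tiled by `(2·L^{K−j})^d` M-cubes for EVERY `j ≤ K`, room at the last steps is automatic, and the lower bound on `m` is carried by `M`
(`L^m = M > L²M₁`; with `M₁ = L⁴`: `m ≥ 7`) — this file's ceiling `k + 4 ≤ m + K` never bites there.  THE TREE decouples by design: `Setup.Params` carries `(d, L, m, K)` with NO range
field on `m` beyond `T4Family.hm : 1 ≤ m` (`sitesPerDir j = 2·L^{m+K−j}`, DIVERGENCE F2), `Setup.Consts.M` ∕ `ScalesOrdered` and the junction's `ν₀.M₁` live independently — and the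
junction of record then serves exactly `k ≤ m + K − 4`: at families with `m ∈ {1, 2, 3}` (admitted by `hm`) the top `4 − m` heights are out of its reach.  Whether `hm` is re-fielded as
print's coupling («`L²·M₁ < L^m`», DIVERGENCE-F class like `hL11`) or the decoupling merely recorded is the typer's ∕ DEF-1's range-field call, and the plan's if served instances move
((Q108)(a), plan g94 WORD (E) 2026-08-30T01:50Z: NO consumer of record pins instance heights today — the E1 column is generic in `k`; the PINNED layer of record λˣ has
`kSel := P.K − 1`, print's LAST basic step, so a top-layer instance of height `k = K − 1` meets this ceiling as the range condition `3 ≤ m`: the tree's families `m ∈ {1, 2}` are exactly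
where v14ᴸ cannot serve it); this file decides neither — it records the ceiling, its sharpness, and the printed coupling that explains it.

HONEST FRAMING.  Three arithmetic theorems over displayed rows; nothing of the tree is refuted (every junction ∕ head ∕ socket stands as typed); nothing of Bałaban's asserted or
refuted; N12 NOT discharged; K0⁷ ∕ K1⁹ OPEN; counts unmoved (typed 28∕28 · discharged 8∕28, 8∕27 excl. NODE O); one finite 𝕋⁴ programme at fixed `ε = L^{-K}` — R4 closes only the
conditional rung `BalabanLadder.UV`; nothing continuum ∕ ℝ⁴ ∕ OS; the Yang–Mills mass gap (Clay) is NOT proved by any of this.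
-/

namespace Summit.QuantumFields.YangMills.BalabanUVNodes.N12JunctionHeightCeiling

open Literature.MathematicalPhysics.QuantumFieldTheory.Balaban1983to89
open Literature.MathematicalPhysics.QuantumFieldTheory.Balaban1983to89.T4Continuum (T4Family)
open B14.Eq213MaximalDomains (side)

variable {F : T4Family}

/-! ## §1  The ceiling: `hM₁₀ ∧ hdiv₀ ⊢ k + 4 ≤ m + K` -/

/-- ★★ **THE JUNCTION's `M₁`-ROWS FORCE A HEIGHT CEILING `k + 4 ≤ m + K`.**  At one instance of the junction of record v14ᴸ (`Θ.ν.M₁ = ν₀.M₁ ↦ M₁`, `k P i ↦ k`), the displayed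
rows `hM₁₀ : ((d+4)L+6)·L² ≤ M₁` and `hdiv₀ : side L M₁ k ∣ sitesPerDir 0` (`= Lᵏ·M₁ ∣ 2·L^{m+K}`) give `2·L^{k+3} < Lᵏ·M₁ ≤ 2·L^{m+K}`, hence `k + 4 ≤ m + K` — three steps below
the displayed `hk1 : k + 1 ≤ m + K`.  Only `1 < L` of the lattice is used.  Typing-range certificate; count-neutral; nothing of Bałaban's asserted.
[cite: Balaban1988Convergent, (2.13) pp.256–257; Balaban1987RG1, (0.1) p.251; Balaban1985Variational, (7) p.278] -/
theorem height_add_four_le_of_cubeRows (P : B12.RunParams) {k M₁ : ℕ}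
    (hM₁₀ : (((F.P P.K).d + 4) * (F.P P.K).L + 6) * (F.P P.K).L ^ 2 ≤ M₁)
    (hdiv₀ : side (F.P P.K).L M₁ k ∣ (F.P P.K).sitesPerDir 0) :
    k + 4 ≤ F.m + P.K := by
  have hL : 1 < (F.P P.K).L := (F.P P.K).hL.2
  have hL0 : 0 < (F.P P.K).L := by omega
  -- the cube row as an inequality: `Lᵏ·M₁ ≤ 2·L^{m+K}`
  have hsz : (F.P P.K).sitesPerDir 0 = 2 * (F.P P.K).L ^ (F.m + P.K) := by
    simp [Params.sitesPerDir]
  have hle : (F.P P.K).L ^ k * M₁ ≤ 2 * (F.P P.K).L ^ (F.m + P.K) := by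
    have h := Nat.le_of_dvd (by rw [hsz]; positivity) hdiv₀
    simpa [side, hsz] using h
  -- `M₁ > 2L³` from `hM₁₀`
  have hM : 2 * (F.P P.K).L ^ 3 < M₁ := by
    have h6 : 0 < 6 * (F.P P.K).L ^ 2 := by positivity
    have h4 : 2 * (F.P P.K).L ^ 3 ≤ ((F.P P.K).d + 4) * (F.P P.K).L * (F.P P.K).L ^ 2 := by
      have : 2 ≤ ((F.P P.K).d + 4) := by omega
      calc 2 * (F.P P.K).L ^ 3 = 2 * ((F.P P.K).L * (F.P P.K).L ^ 2) := by ring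
        _ ≤ ((F.P P.K).d + 4) * ((F.P P.K).L * (F.P P.K).L ^ 2) := Nat.mul_le_mul_right _ this
        _ = ((F.P P.K).d + 4) * (F.P P.K).L * (F.P P.K).L ^ 2 := by ring
    have h5 : (((F.P P.K).d + 4) * (F.P P.K).L + 6) * (F.P P.K).L ^ 2 = ((F.P P.K).d + 4) * (F.P P.K).L * (F.P P.K).L ^ 2 + 6 * (F.P P.K).L ^ 2 := by ring
    omega
  -- `2·L^{k+3} < Lᵏ·M₁ ≤ 2·L^{m+K}` ⇒ `k + 3 < m + K`
  have hlt : 2 * (F.P P.K).L ^ (k + 3) < 2 * (F.P P.K).L ^ (F.m + P.K) := by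
    have h1 : (F.P P.K).L ^ k * (2 * (F.P P.K).L ^ 3) < (F.P P.K).L ^ k * M₁ := Nat.mul_lt_mul_of_pos_left hM (by positivity)
    calc 2 * (F.P P.K).L ^ (k + 3) = (F.P P.K).L ^ k * (2 * (F.P P.K).L ^ 3) := by ring
      _ < (F.P P.K).L ^ k * M₁ := h1
      _ ≤ 2 * (F.P P.K).L ^ (F.m + P.K) := hle
  have hpow : (F.P P.K).L ^ (k + 3) < (F.P P.K).L ^ (F.m + P.K) := by omega
  by_contra hcon
  have hge : F.m + P.K ≤ k + 3 := by omega
  have := Nat.pow_le_pow_right hL0 hge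
  omega

/-! ## §2  Sharpness: at `d = 4`, `L` odd `> 11`, `M₁ := L⁴` meets every displayed `M₁`-row at every height `k ≤ m + K − 4` -/

/-- ★★ **THE CEILING IS SHARP.**  For a `T4Family` (`d = 4`, `L` odd and `> 11`, so `L ≥ 13`) and every height with `k + 4 ≤ F.m + P.K`, the εreg-blind numerics `M₁ := L⁴` meet ALL
six `M₁`-rows the junction of record displays — `hfloor₀ : (d+14)L ≤ M₁`, `hMrad₀ : (4d + m′)L² + 2dL + 12 ≤ M₁` (`m′ = 3(d(L−1)∕2)+5`), `hM₁₀ : ((d+4)L+6)L² ≤ M₁`,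
`hdiv₀ : side L M₁ k ∣ sitesPerDir 0`, `hM4 : 4L ≤ M₁`, `hM2 : 2 ≤ M₁` — written verbatim.  So the junction serves EXACTLY the heights `k ≤ m + K − 4` (§1 + this).  Typing-range
certificate; count-neutral; nothing of Bałaban's asserted. [cite: Balaban1988Convergent, (2.13) pp.256–257; Balaban1987RG1, (0.1) p.251; Balaban1989LargeFieldI, Prop. 1 p.194] -/
theorem cubeRows_of_height_add_four_le (P : B12.RunParams) {k : ℕ} (hk : k + 4 ≤ F.m + P.K) :
    ((F.P P.K).d + 14) * (F.P P.K).L ≤ (F.P P.K).L ^ 4 ∧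
    (4 * (F.P P.K).d + (3 * ((F.P P.K).d * (((F.P P.K).L - 1) / 2)) + 5)) * (F.P P.K).L ^ 2 + 2 * (F.P P.K).d * (F.P P.K).L + 12 ≤ (F.P P.K).L ^ 4 ∧
    (((F.P P.K).d + 4) * (F.P P.K).L + 6) * (F.P P.K).L ^ 2 ≤ (F.P P.K).L ^ 4 ∧
    side (F.P P.K).L ((F.P P.K).L ^ 4) k ∣ (F.P P.K).sitesPerDir 0 ∧
    4 * (F.P P.K).L ≤ (F.P P.K).L ^ 4 ∧
    2 ≤ (F.P P.K).L ^ 4 := by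
  have hd : (F.P P.K).d = 4 := T4Family.P_d (F := F) P.K
  have hL13 : 13 ≤ (F.P P.K).L := by
    rw [T4Family.P_L]
    have h11 := F.hL11
    have hodd := F.hL.1
    rcases hodd with ⟨j, hj⟩
    omega
  set L := (F.P P.K).L with hLdef
  have hL2 : 169 ≤ L ^ 2 := by nlinarith
  have hL3 : 13 * L ^ 2 ≤ L ^ 3 := by nlinarith
  have hL4 : 13 * L ^ 3 ≤ L ^ 4 := by nlinarith
  rw [hd]
  refine ⟨by nlinarith, ?_, by nlinarith, ?_, by nlinarith, by nlinarith⟩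
  · -- `m′ ≤ 6L − 1`: `2·((L−1)∕2) ≤ L − 1`
    have hx : (L - 1) / 2 * 2 ≤ L - 1 := Nat.div_mul_le_self (L - 1) 2
    have hx' : 2 * ((L - 1) / 2) + 1 ≤ L := by omega
    have h1 : (4 * 4 + (3 * (4 * ((L - 1) / 2)) + 5)) ≤ 6 * L + 15 := by omega
    have h2 : (4 * 4 + (3 * (4 * ((L - 1) / 2)) + 5)) * L ^ 2 ≤ (6 * L + 15) * L ^ 2 := Nat.mul_le_mul_right _ h1
    nlinarith
  · -- `L^{k}·L⁴ ∣ 2·L^{m+K}` at `k + 4 ≤ m + K`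
    have hsz : (F.P P.K).sitesPerDir 0 = 2 * L ^ (F.m + P.K) := by
      simp [Params.sitesPerDir, hLdef]
    rw [hsz]
    show L ^ k * L ^ 4 ∣ 2 * L ^ (F.m + P.K)
    rw [← pow_add]
    exact Dvd.dvd.mul_left (pow_dvd_pow L hk) 2

/-! ## §3  The quotable sentence: at `F.m ≤ 3` the top `4 − m` heights are out of the junction's reach -/

/-- ★ **NO εreg-BLIND NUMERICS SERVE A HEIGHT ABOVE THE CEILING.**  If `F.m + P.K < k + 4` (e.g. `F.m ≤ 3` and `k ∈ {m+K−3, …, K}`), then NO `M₁` meets the junction's displayed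
rows `hM₁₀ ∧ hdiv₀` at that instance (§1 contraposed).  With `T4Family.hm : 1 ≤ m` only, such families and heights exist in the tree's range (print couples `L^m = M > L²M₁`, [I] p.257,
[III] p.245, so there `m ≥ 7` and nothing is excluded); whether N12's instances are demanded there is the consumer's ∕ the plan's question (dag-n12-d g29 (Q108)(a)).  Typing-range
note; count-neutral; nothing of Bałaban's asserted. [cite: Balaban1987RG1, (0.1) p.251 («m is a positive integer»), p.257 («M = L^m»); Balaban1988Convergent, p.245, (2.13) pp.256–257] -/
theorem not_cubeRows_of_lt (P : B12.RunParams) {k : ℕ} (hk : F.m + P.K < k + 4) (M₁ : ℕ) :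
    ¬ ((((F.P P.K).d + 4) * (F.P P.K).L + 6) * (F.P P.K).L ^ 2 ≤ M₁ ∧ side (F.P P.K).L M₁ k ∣ (F.P P.K).sitesPerDir 0) :=
  fun h => absurd (height_add_four_le_of_cubeRows P h.1 h.2) (by omega)

/-! ## §4  (v1.1, 2026-08-30 — plan g94 WORDS (F)∕(H) «r2′», node00-def-Y WORDS 76–78) The K-FREE compatibility row at a top-layer pin: `M₁ ∣ L^m` serves `hdiv₀` at EVERY height `k ≤ K` -/

/-- ★★ **THE PIN's ONE K-FREE COMPATIBILITY ROW DISCHARGES `hdiv₀` AT EVERY HEIGHT `k ≤ K`.**  If the εreg-blind numerics' cube scale divides the physical torus factor, `M₁ ∣ L^m`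
(print's coupling `M = L^m`, [I] p.257; [III] p.257 «we assume that all partitions are compatible»), then the junction's per-instance cube row `hdiv₀ : side L M₁ k ∣ sitesPerDir 0`
holds at every height `k ≤ P.K`: `Lᵏ·M₁ ∣ L^{k+m} ∣ L^{m+K} ∣ 2·L^{m+K}`.  This is r2′'s row (node00-def-Y WORD-76, plan g94 WORD (F)): an author who WANTS every height `≤ K` on the
`m`-compatible sub-family displays `M₁ ∣ L^m` once at the pin and derives `hdiv₀`; with the head's floor `hM₁₀` (`M₁ > 2L³`) it forces `4 ≤ m` (§1 at `k = K`), the family-level residue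
— which K0⁷'s registered grid guard `A‴(c,c₀,c₁)` already carries as its conjuncts `k + c₀ ≤ m + K` ∕ `L^{c₁} ∣ M` (plan g94 WORD (H)).  Count-neutral; nothing of Bałaban's asserted.
[cite: Balaban1987RG1, (0.1) p.251, p.257 («M = L^m»); Balaban1988Convergent, (2.13) pp.256–257, p.257 («compatible partitions»)] -/
theorem cubeRow_of_dvd_pow_m (P : B12.RunParams) {k M₁ : ℕ} (hM : M₁ ∣ (F.P P.K).L ^ F.m) (hk : k ≤ P.K) :
    side (F.P P.K).L M₁ k ∣ (F.P P.K).sitesPerDir 0 := by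
  have hsz : (F.P P.K).sitesPerDir 0 = 2 * (F.P P.K).L ^ (F.m + P.K) := by simp [Params.sitesPerDir]
  rw [hsz]
  show (F.P P.K).L ^ k * M₁ ∣ 2 * (F.P P.K).L ^ (F.m + P.K)
  have h1 : (F.P P.K).L ^ k * M₁ ∣ (F.P P.K).L ^ k * (F.P P.K).L ^ F.m := Nat.mul_dvd_mul_left _ hM
  have h2 : (F.P P.K).L ^ k * (F.P P.K).L ^ F.m ∣ (F.P P.K).L ^ (F.m + P.K) := by
    rw [← pow_add]; exact pow_dvd_pow _ (by omega)
  exact (h1.trans h2).trans (Dvd.intro_left 2 rfl)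

/-- ★ **… AND WITH THE HEAD's FLOOR IT IS EXACTLY THE FAMILY-LEVEL RESIDUE `4 ≤ m`.**  `hM₁₀` (`((d+4)L+6)L² ≤ M₁`) and the K-free row `M₁ ∣ L^m` give `4 ≤ F.m` (the numerics' cube is
wider than `2L³`, so it fits the physical torus factor only from `m = 4` on); conversely at `4 ≤ F.m`, `M₁ := L⁴` meets the floor rows (§2) and `L⁴ ∣ L^m`.  r2′'s displayed residue,
as the plan booked it (WORD (F)); count-neutral; nothing of Bałaban's asserted. [cite: Balaban1987RG1, p.257, Thm 3 p.264 («M ≥ M(κ)»); Balaban1988Convergent, p.245 («M₁ < M₂ < M»)] -/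
theorem four_le_m_of_hM10_of_dvd_pow_m (P : B12.RunParams) {M₁ : ℕ}
    (hM₁₀ : (((F.P P.K).d + 4) * (F.P P.K).L + 6) * (F.P P.K).L ^ 2 ≤ M₁) (hM : M₁ ∣ (F.P P.K).L ^ F.m) :
    4 ≤ F.m := by
  have h := height_add_four_le_of_cubeRows (F := F) P (k := P.K) hM₁₀ (cubeRow_of_dvd_pow_m P hM le_rfl)
  omega

end Summit.QuantumFields.YangMills.BalabanUVNodes.N12JunctionHeightCeiling
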